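import Literature.AlgebraicGeometry.Resolution.WeightedCentreMonomialCurve
import Literature.AlgebraicGeometry.Resolution.WeightedCentreStrictWeightIdeal
import HarnessLib

/-!
# THEOREM RZ's endgame, assembled (instrument for the `W(f)` toy model — NOT a resolution theorem)

One theorem (ours, bookkeeping over [Lang2002, Ch. IV §1]) composing the cell's generic instruments
`WeightedCentreMonomialCurve` (v2) and `WeightedCentreStrictWeightIdeal` into the last paragraph of the engine's
THEOREM RZ (cell notes RE-DERIVATION-eng1-g41 §3.7.4, "Case `C* = f` … so the `Z`-weight-`p d*` component of
`(E_{p²})` reads `c₁ α^p = 0`"):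

`eq_zero_of_isotropy` — DATA: `ℕ`-valued variable weights `zw` (the `Z`-weight), two shift columns
`v 0, v 1 : ι → MvPolynomial ι K` (the blocks `P₁`, `P_p`, already at `σ = 1`) whose monomials weigh `≥ zw j + d₁`,
resp. `≥ zw j + d*`, the second column concentrated in one slot `i` with value `α`, `α` homogeneous of weight `d*`,
`(★) d* < p d₁`, `G = X i ^ p * C c + R` with `c ≠ 0` and `degreeOf i R < p` (the pin `c₁ f₁^p` of `f₁`), and a ring
endomorphism `Φ` of `(MvPolynomial ι K)[X]` fixing `K`, acting on the variables by the shift along the curve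
`(λ, μ) = (σ, σ^p)`, and fixing `C G` (the isotropy equation `g(x + σ P₁ + σ^p P_p) = g`).  CONCLUSION: `α = 0`.
PROOF: `MonomialCurve.mul_pow_eq_neg_sum` (`C c * α^p = - Σ_{l<p} Ψ_{(p(p-l), l)}`),
`MonomialCurve.le_weight_of_mem_support_coeff_multiShift` (`Ψ_{(k,l)}` weighs `≥ k d₁ + l d*`) and
`StrictWeightIdeal.eq_zero_of_C_mul_pow_eq_neg_sum`.

What is NOT here (engine-specific, RE-DERIVATION §3.7.1–3.7.4): LEMMA S (shapes), LEMMAS G/C/L (that only the orders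
`1` and `p` survive and that `P_p ≠ 0`), the reduction to ONE slot `i` (`dim Θ = 1` via the Frobenius splitting of
`WeightedCentreInvariantDirection`) and the case `C* =` an `I`-class.

VALUE: bookkeeping for a toy model (Resolution Observatory cell `pub-rosobs`, carver lane gen 62; AI-written Lean, and
AI review is weaker than expert review); NOT a statement about the invariant of [AbramovichTemkinWlodarczyk2024], NOT
progress on the summit.
-/

namespace Literature.AlgebraicGeometry.Resolution.WeightedBlowup

namespace RZEndgame

open MvPolynomial

/-- (ours, bookkeeping) THEOREM RZ's endgame in the `W(f)` toy model, generic form: see the module docstring.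
[cite: Lang2002, Ch. IV §1] -/
theorem eq_zero_of_isotropy {K : Type*} [CommRing K] [IsDomain K] {ι : Type*} [DecidableEq ι] (zw : ι → ℕ)
    {p d₁ dstar : ℕ} (hp : p ≠ 0) (hstar : dstar < p * d₁) (v : Fin 2 → ι → MvPolynomial ι K)
    (hv0 : ∀ j, ∀ m ∈ (v 0 j).support, zw j + d₁ ≤ Finsupp.weight zw m)
    (hv1 : ∀ j, ∀ m ∈ (v 1 j).support, zw j + dstar ≤ Finsupp.weight zw m)
    {i : ι} {α : MvPolynomial ι K} (hvi : ∀ j, v 1 j = if j = i then α else 0)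
    (hα : IsWeightedHomogeneous zw α dstar) {G R : MvPolynomial ι K} {c : K} (hc : c ≠ 0)
    (hG : G = X i ^ p * C c + R) (hR : degreeOf i R < p)
    (Φ : Polynomial (MvPolynomial ι K) →+* Polynomial (MvPolynomial ι K))
    (hC : ∀ a : K, Φ (Polynomial.C (C a)) = Polynomial.C (C a))
    (hX : ∀ j, Φ (Polynomial.C (X j))
      = Polynomial.C (X j) + ∑ t, Polynomial.X ^ (![1, p] : Fin 2 → ℕ) t * Polynomial.C (v t j))
    (hΦ : Φ (Polynomial.C G) = Polynomial.C G) : α = 0 := by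
  refine StrictWeightIdeal.eq_zero_of_C_mul_pow_eq_neg_sum zw hp hstar hc hα
    (fun l => coeff (Finsupp.single 0 (p * p - p * l) + Finsupp.single 1 l) (MonomialCurve.multiShift v G))
    (fun l _ m hm => ?_) ?_
  · have h := MonomialCurve.le_weight_of_mem_support_coeff_multiShift hv0 hv1 G _ hm
    have e0 : (Finsupp.single (0 : Fin 2) (p * p - p * l) + Finsupp.single 1 l : Fin 2 →₀ ℕ) 0 = p * p - p * l := by
      simp
    have e1 : (Finsupp.single (0 : Fin 2) (p * p - p * l) + Finsupp.single 1 l : Fin 2 →₀ ℕ) 1 = l := by simp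
    rwa [e0, e1] at h
  · exact MonomialCurve.mul_pow_eq_neg_sum hp v hvi hG (by simp [vars_C]) hR Φ hC hX hΦ

/-- (ours, bookkeeping) The same with the conclusion in the engine's words: under the hypotheses of
`eq_zero_of_isotropy` except `α`'s vanishing being what is tested, the second shift column is zero (`P_p = 0`).
[cite: Lang2002, Ch. IV §1] -/
theorem column_eq_zero_of_isotropy {K : Type*} [CommRing K] [IsDomain K] {ι : Type*} [DecidableEq ι] (zw : ι → ℕ)
    {p d₁ dstar : ℕ} (hp : p ≠ 0) (hstar : dstar < p * d₁) (v : Fin 2 → ι → MvPolynomial ι K)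
    (hv0 : ∀ j, ∀ m ∈ (v 0 j).support, zw j + d₁ ≤ Finsupp.weight zw m)
    (hv1 : ∀ j, ∀ m ∈ (v 1 j).support, zw j + dstar ≤ Finsupp.weight zw m)
    {i : ι} {α : MvPolynomial ι K} (hvi : ∀ j, v 1 j = if j = i then α else 0)
    (hα : IsWeightedHomogeneous zw α dstar) {G R : MvPolynomial ι K} {c : K} (hc : c ≠ 0)
    (hG : G = X i ^ p * C c + R) (hR : degreeOf i R < p)
    (Φ : Polynomial (MvPolynomial ι K) →+* Polynomial (MvPolynomial ι K))
    (hC : ∀ a : K, Φ (Polynomial.C (C a)) = Polynomial.C (C a))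
    (hX : ∀ j, Φ (Polynomial.C (X j))
      = Polynomial.C (X j) + ∑ t, Polynomial.X ^ (![1, p] : Fin 2 → ℕ) t * Polynomial.C (v t j))
    (hΦ : Φ (Polynomial.C G) = Polynomial.C G) : v 1 = 0 := by
  have hα0 := eq_zero_of_isotropy zw hp hstar v hv0 hv1 hvi hα hc hG hR Φ hC hX hΦ
  funext j
  rw [hvi j, hα0, ite_self, Pi.zero_apply]

end RZEndgame

end Literature.AlgebraicGeometry.Resolution.WeightedBlowup
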